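/-
COR-CM (cell pub-hodgecm2, stage 2 of the Hodge ladder) — count-neutral KERNEL COMBINATORICS «the sheared dihedral family», part XIV: transport from
the slice model to the intrinsic currency (seat prover-pub-hodgecm2-b23-g52-0, binder prover b23, gen 52; claim «SYLOW TRANSFER XII + THE SHEARED
DIHEDRAL FAMILY», HOME/INBOX.md l.23708).  PORT of gen 44ʼs `Census/QuarticInversionTransport.lean` §§1–5, 7 (§6 blocks waits for the S-block file)
with `translS`/`orbSpanS`: bookkeeping definitions with bodies (`tr`, `gfOf`) + theorems, on parts VII/VIII/XII/XIII and gen 44ʼs files BY NAME; no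
`decide`, no certificate, no named fact, no `sorry`.  `Interfaces.lean` (C1), every E term, B01, `Transposition/*`, `PortJoin/*`, `D2Bridge/*` untouched.
HONEST FRAMING: `HC_CM` is NOT proved, here or anywhere in the tree; nothing here is a period, a count of record or a headline.
-/
import Summits.HodgeConjecture.CorCM.Census.ShearedDihedralSlicePlaces
import Summits.HodgeConjecture.CorCM.Census.ShearedDihedralOrbit
import Summits.HodgeConjecture.CorCM.Census.TwistGenerationDescent

/-!
# The sheared dihedral family, XIV: transport — a model family generating `hodge₄` modulo pairs gives intrinsic faces generating `hodgeSpan`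

Along a slice datum `D` (parts VII–VIII): the linear isomorphism **`tr : ℤ[Ty₄ A] ≃ ℤ[CMF G c]`** (`typeEquiv`), pairs to pairs (`tr_pairVec₄`,
`map_pairs₄`), the three motions to base changes (**`tr_translH₄`, `tr_translY`, `tr_translS`** — `translS` is base change along the involution `t = s`),
model faces to abstract faces plus two pairs (`tr_faceVec₄`, `gface_mem`, `gfOf`, `gfOf_spec`), and the consequence the law needs:
**`exists_gfaces_of_family`** — if `hodge₄ ≤ pairs₄ ⊔ orbSpanS ζ F` for a finite family `F` of model faces, then at most `|F|` abstract faces have base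
changes spanning `hodgeSpan c` together with the pairs (input of part IIʼs `isLeast_of_exists`).  gen 44ʼs §6 (model blocks = intrinsic blocks) is
left to the S-block file.  All [folklore].

## References
* [Pohlmann1968] H. Pohlmann, Algebraic cycles on abelian varieties of complex multiplication type, Ann. of Math. 88 (1968), Thm 1.
-/

namespace Summit.HodgeConjecture.CorCM.Census.ShearedDihedral

open Summit.HodgeConjecture.CorCM.Census.QuarticInversion

open Finset
open Summit.HodgeConjecture.CorCM.Prior.AllgGroup.RfwfAllgGroup
open Summit.HodgeConjecture.CorCM.Census.BlockParity
open Summit.HodgeConjecture.CorCM.Census.Coinvariant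
open Summit.HodgeConjecture.CorCM.Census.OddSliceFacesModel

noncomputable section

variable {G : Type*} [Group G] [Fintype G] [DecidableEq G] {c : G}
variable {A : Type} [AddCommGroup A] [Fintype A] [DecidableEq A] {ζ : ZMod 2}
variable (D : SliceDatum G c A ζ)

/-! ## §1 The transport isomorphism -/

/-- **The transport** `e_Θ ↦ [typeOf Θ]`. [folklore] -/
def tr : (Ty₄ A → ℤ) ≃ₗ[ℤ] (CMF G c →₀ ℤ) :=
  (Finsupp.linearEquivFunOnFinite ℤ ℤ (Ty₄ A)).symm ≪≫ₗ Finsupp.domLCongr (typeEquiv D).symm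

omit [DecidableEq A] in
/-- **Unit vectors go to types** (through the dictionary `typeEquiv`). [folklore] -/
theorem tr_single₄ (Θ : Ty₄ A) (n : ℤ) : tr D (Pi.single Θ n) = Finsupp.single ((typeEquiv D).symm Θ) n := by
  rw [tr, LinearEquiv.trans_apply, Finsupp.linearEquivFunOnFinite_symm_single, Finsupp.domLCongr_single]

/-- A vector is the sum of its transported unit vectors (through the dictionary). [folklore] -/
theorem tr_eq_sum₄ (v : Ty₄ A → ℤ) : tr D v = ∑ Θ, Finsupp.single ((typeEquiv D).symm Θ) (v Θ) := by
  conv_lhs => rw [← Finset.univ_sum_single v]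
  rw [map_sum]
  exact Finset.sum_congr rfl fun Θ _ => tr_single₄ D Θ (v Θ)

/-! ## §2 Pairs -/

omit [DecidableEq A] in
/-- The type of the conjugate label is the base change along `c` (private: column-generic statement, gen 44 has the `Datum` twin). [folklore] -/
private theorem typeOf_conj₄ (Θ : Ty₄ A) : typeOf D (conj₄ A Θ) = rt c c (typeOf D Θ) := by
  rw [conj₄_eq_twH₄, (typeOf_tw_gens D).1, D.map_c]

omit [DecidableEq A] in
/-- **Pairs go to pairs.** [folklore] -/
theorem tr_pairVec₄ (Θ : Ty₄ A) : tr D (pairVec₄ A Θ) = pair c (typeOf D Θ) := by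
  rw [pairVec₄, map_add, tr_single₄, tr_single₄, typeEquiv_symm_apply, typeEquiv_symm_apply, pair, typeOf_conj₄]

omit [DecidableEq A] in
/-- **The divisor lattices agree**: `tr (pairs₄ A) = ℤ⟨pairSet c⟩`. [folklore] -/
theorem map_pairs₄ : (pairs₄ A).map (tr D : (Ty₄ A → ℤ) →ₗ[ℤ] (CMF G c →₀ ℤ)) = Submodule.span ℤ (pairSet c) := by
  rw [pairs₄, Submodule.map_span, ← Set.range_comp]
  have h : ((tr D : (Ty₄ A → ℤ) →ₗ[ℤ] (CMF G c →₀ ℤ)) ∘ pairVec₄ A) = pair c ∘ typeOf D :=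
    funext fun Θ => by rw [Function.comp_apply, Function.comp_apply, LinearEquiv.coe_coe, tr_pairVec₄]
  have hsurj : Function.Surjective (typeOf (c := c) D) := (typeEquiv D).symm.surjective
  rw [h, hsurj.range_comp]
  rfl

omit [Fintype A] [DecidableEq A] in
include D in
/-- **`ℤ⟨pairSet⟩` is base-change stable** (map form; `c` central along the datum). [folklore] -/
private theorem span_pairSet_map_rt_le (Q : G) :
    (Submodule.span ℤ (pairSet c)).map (Finsupp.lmapDomain ℤ ℤ (rt c Q)) ≤ Submodule.span ℤ (pairSet c) := by
  rw [Submodule.map_span, Submodule.span_le]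
  rintro _ ⟨z, ⟨Ψ, rfl⟩, rfl⟩
  exact Submodule.subset_span ⟨rt c Q Ψ, by rw [Finsupp.lmapDomain_apply]; exact (mapDomain_rt_pair_eq c (mul_c_comm D) Q Ψ).symm⟩

/-! ## §3 Motions are base changes -/

/-- **`tr (h_a · v) = (tr v)·(ι a)⁻¹`.** [folklore] -/
theorem tr_translH₄ (a : ZMod 2 × A) (v : Ty₄ A → ℤ) : tr D (translH₄ A a v) = Finsupp.mapDomain (rt c (D.ι a)) (tr D v) := by
  have hv : translH₄ A a v = translH₄Hom A a (∑ Θ, Pi.single Θ (v Θ)) := by rw [translH₄Hom_apply, Finset.univ_sum_single]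
  rw [hv, map_sum, map_sum, tr_eq_sum₄ D v, Finsupp.mapDomain_finsetSum]
  refine Finset.sum_congr rfl fun Θ _ => ?_
  rw [translH₄Hom_apply, translH₄_single, tr_single₄, typeEquiv_symm_apply, typeEquiv_symm_apply, (typeOf_tw_gens D).1, Finsupp.mapDomain_single]

/-- **`tr (y · v) = (tr v)·y⁻¹`.** [folklore] -/
theorem tr_translY (v : Ty₄ A → ℤ) : tr D (translY A ζ v) = Finsupp.mapDomain (rt c D.y) (tr D v) := by
  have hv : translY A ζ v = translYHom A ζ (∑ Θ, Pi.single Θ (v Θ)) := by rw [translYHom_apply, Finset.univ_sum_single]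
  rw [hv, map_sum, map_sum, tr_eq_sum₄ D v, Finsupp.mapDomain_finsetSum]
  refine Finset.sum_congr rfl fun Θ _ => ?_
  rw [translYHom_apply, translY_single, tr_single₄, typeEquiv_symm_apply, typeEquiv_symm_apply, (typeOf_tw_gens D).2.1, Finsupp.mapDomain_single]

/-- **`tr (t · v) = (tr v)·t⁻¹`.** [folklore] -/
theorem tr_translS (v : Ty₄ A → ℤ) : tr D (translS A v) = Finsupp.mapDomain (rt c D.t) (tr D v) := by
  have hv : translS A v = translSHom A (∑ Θ, Pi.single Θ (v Θ)) := by rw [translSHom_apply, Finset.univ_sum_single]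
  rw [hv, map_sum, map_sum, tr_eq_sum₄ D v, Finsupp.mapDomain_finsetSum]
  refine Finset.sum_congr rfl fun Θ _ => ?_
  rw [translSHom_apply, translS_single, tr_single₄, typeEquiv_symm_apply, typeEquiv_symm_apply, typeOf_twS, Finsupp.mapDomain_single]

/-! ## §4 Faces: the model's faces are abstract faces plus two pairs -/

/-- **`tr (faceVec₄ Θ p q) = gface (typeOf Θ) (word p) (word q) + pair + pair`.** [folklore] -/
theorem tr_faceVec₄ (hc2 : c * c = 1) (Θ : Ty₄ A) (p q : Pl A) :
    tr D (faceVec₄ A Θ p q) = gface c hc2 (typeOf D Θ) (word D p.1 (0, p.2)) (word D q.1 (0, q.2)) +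
      pair c (typeOf D (flipAt A p Θ)) + pair c (typeOf D (flipAt A q Θ)) := by
  rw [faceVec₄, map_add, map_add, map_add, tr_single₄, tr_single₄, tr_single₄, tr_single₄, typeEquiv_symm_apply, typeEquiv_symm_apply,
    typeEquiv_symm_apply, typeEquiv_symm_apply, gface, pair, pair, typeOf_conj₄, typeOf_conj₄,
    typeOf_flipAt D hc2 p (flipAt A q Θ), typeOf_flipAt D hc2 q Θ, typeOf_flipAt D hc2 p Θ]
  abel

omit [Fintype G] [Fintype A] [DecidableEq A] in
/-- The place of `word k (e, s)` is the place of `word k (0, s)`. [folklore] -/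
private theorem orb_word_mk (hc2 : c * c = 1) (k : Fin 4) (e : ZMod 2) (s : A) : orb c (word D k (e, s)) = orb c (word D k (0, s)) := by
  have h01 : ∀ u : ZMod 2, u = 0 ∨ u = 1 := by decide
  rcases h01 e with rfl | rfl
  · rfl
  · have hw : word D k (1, s) = c * word D k (0, s) := by
      rw [c_mul_word]; congr 1; ext <;> simp
    rw [hw, orb, orb, ← mul_assoc, hc2, one_mul, Finset.pair_comm]

omit [Fintype A] [DecidableEq A] in
/-- Flipping at `word k (e, s)` is flipping at `word k (0, s)`. [folklore] -/
private theorem oflipCM_word_mk (hc2 : c * c = 1) (k : Fin 4) (e : ZMod 2) (s : A) (X : CMF G c) :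
    oflipCM c hc2 (word D k (e, s)) X = oflipCM c hc2 (word D k (0, s)) X := by
  apply Subtype.ext
  show oflip c (word D k (e, s)) X.1 = oflip c (word D k (0, s)) X.1
  rw [oflip, oflip, orb_word_mk D hc2]

/-- **Every abstract face is a transported Hodge vector of the model up to two pairs.** [folklore] -/
theorem gface_mem (hc2 : c * c = 1) (Φ : CMF G c) {t t' : G} (ht' : t' ∉ orb c t) :
    gface c hc2 Φ t t' ∈ (hodge₄ A).map (tr D : (Ty₄ A → ℤ) →ₗ[ℤ] (CMF G c →₀ ℤ)) ⊔ Submodule.span ℤ (pairSet c) := by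
  obtain ⟨k, ⟨e, s⟩, rfl⟩ := exists_word D t
  obtain ⟨k', ⟨e', s'⟩, rfl⟩ := exists_word D t'
  have hpq : ((k, s) : Pl A) ≠ (k', s') := fun h => ht' (by
    rw [word_mem_orb_word_iff]; exact ⟨(Prod.mk.inj h).1.symm, (Prod.mk.inj h).2.symm⟩)
  have hΦ : Φ = typeOf D (ty D Φ) := (typeOf_ty D Φ).symm
  have hP : ∀ Ψ : CMF G c, pair c Ψ ∈ Submodule.span ℤ (pairSet c) := fun Ψ => Submodule.subset_span (pair_mem_pairSet c Ψ)
  have e1 : gface c hc2 Φ (word D k (e, s)) (word D k' (e', s')) = gface c hc2 Φ (word D k (0, s)) (word D k' (0, s')) := by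
    simp only [gface, oflipCM_word_mk D hc2]
  have e2 := tr_faceVec₄ D hc2 (ty D Φ) (k, s) (k', s')
  rw [← hΦ] at e2
  have e3 : gface c hc2 Φ (word D k (0, s)) (word D k' (0, s')) = tr D (faceVec₄ A (ty D Φ) (k, s) (k', s')) -
      pair c (typeOf D (flipAt A (k, s) (ty D Φ))) - pair c (typeOf D (flipAt A (k', s') (ty D Φ))) := by
    rw [e2]; abel
  rw [e1, e3]
  exact Submodule.sub_mem _ (Submodule.sub_mem _ (Submodule.mem_sup_left ⟨_, faceVec₄_mem A _ hpq, rfl⟩)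
    (Submodule.mem_sup_right (hP _))) (Submodule.mem_sup_right (hP _))

/-! ## §5 The abstract face attached to a model face -/

/-- **The abstract face attached to a model face** `faceVec₄ Θ p q` (`p ≠ q`; a choice of presentation; junk `0` otherwise). [folklore] -/
def gfOf (hc2 : c * c = 1) (f : Ty₄ A → ℤ) : CMF G c →₀ ℤ :=
  if h : ∃ q : Ty₄ A × Pl A × Pl A, q.2.1 ≠ q.2.2 ∧ f = faceVec₄ A q.1 q.2.1 q.2.2 then
    gface c hc2 (typeOf D h.choose.1) (word D h.choose.2.1.1 (0, h.choose.2.1.2)) (word D h.choose.2.2.1 (0, h.choose.2.2.2))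
  else 0

/-- **The attached abstract face is an abstract face at two distinct places and differs from the transported class by two pairs.** [folklore] -/
theorem gfOf_spec (hc2 : c * c = 1) {f : Ty₄ A → ℤ} (hf : ∃ Θ p q, p ≠ q ∧ f = faceVec₄ A Θ p q) :
    gfOf D hc2 f ∈ gfaceSet G c hc2 ∧ tr D f - gfOf D hc2 f ∈ Submodule.span ℤ (pairSet c) := by
  have h : ∃ q : Ty₄ A × Pl A × Pl A, q.2.1 ≠ q.2.2 ∧ f = faceVec₄ A q.1 q.2.1 q.2.2 := by
    obtain ⟨Θ, p, q, hpq, rfl⟩ := hf; exact ⟨(Θ, p, q), hpq, rfl⟩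
  have hP : ∀ Ψ : CMF G c, pair c Ψ ∈ Submodule.span ℤ (pairSet c) := fun Ψ => Submodule.subset_span (pair_mem_pairSet c Ψ)
  obtain ⟨hq, hfq⟩ := h.choose_spec
  rw [gfOf, dif_pos h]
  refine ⟨⟨_, _, _, word_not_mem_orb_of_ne D hq, rfl⟩, ?_⟩
  have e := tr_faceVec₄ D hc2 h.choose.1 h.choose.2.1 h.choose.2.2
  rw [← hfq] at e
  rw [e, show ∀ x y z : CMF G c →₀ ℤ, x + y + z - x = y + z from fun x y z => by abel]
  exact Submodule.add_mem _ (hP _) (hP _)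

/-! ## §7 The transported count -/

include D in
/-- **Transport of a generating family of model faces.**  If the `G_ζ(B)`-translates of a finite family `F` of model faces, together with
the pairs, span `hodge₄`, then the attached abstract faces (at most `|F|` of them) have base changes spanning `hodgeSpan c` together with the
pairs. [folklore] -/
theorem exists_gfaces_of_family (hc2 : c * c = 1) {F : Finset (Ty₄ A → ℤ)} (hF : ∀ f ∈ F, ∃ Θ p q, p ≠ q ∧ f = faceVec₄ A Θ p q)
    (hgen : hodge₄ A ≤ pairs₄ A ⊔ orbSpanS A ζ ↑F) :
    ∃ S' : Finset (CMF G c →₀ ℤ), ↑S' ⊆ gfaceSet G c hc2 ∧ S'.card ≤ F.card ∧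
      hodgeSpan c hc2 ≤ Submodule.span ℤ (pairSet c) ⊔ Submodule.span ℤ (translates c S') := by
  set S' := F.image (gfOf D hc2) with hS'
  set T : Submodule ℤ (CMF G c →₀ ℤ) := Submodule.span ℤ (pairSet c) ⊔ Submodule.span ℤ (translates c S') with hT
  have hTstab : ∀ Q : G, ∀ x ∈ T, Finsupp.mapDomain (rt c Q) x ∈ T := by
    intro Q x hx
    obtain ⟨x₁, h₁, x₂, h₂, rfl⟩ := Submodule.mem_sup.mp hx
    rw [Finsupp.mapDomain_add]
    exact Submodule.add_mem _
      (Submodule.mem_sup_left (span_pairSet_map_rt_le D Q (Submodule.mem_map_of_mem (f := Finsupp.lmapDomain ℤ ℤ (rt c Q)) h₁)))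
      (Submodule.mem_sup_right (TwistGeneration.mapDomain_rt_mem_span_translates c Q S' h₂))
  have horb : orbSpanS A ζ ↑F ≤ T.comap (tr D : (Ty₄ A → ℤ) →ₗ[ℤ] (CMF G c →₀ ℤ)) := by
    refine orbSpanS_le A ζ ?_ ?_ ?_ ?_
    · intro f hf
      obtain ⟨hS, hp⟩ := gfOf_spec D hc2 (hF f hf)
      have hmem : gfOf D hc2 f ∈ S' := Finset.mem_image_of_mem _ hf
      have e : tr D f = gfOf D hc2 f + (tr D f - gfOf D hc2 f) := by abel
      show (tr D : (Ty₄ A → ℤ) →ₗ[ℤ] (CMF G c →₀ ℤ)) f ∈ T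
      rw [LinearEquiv.coe_coe, e]
      refine Submodule.add_mem _ (Submodule.mem_sup_right (Submodule.subset_span ⟨1, _, hmem, ?_⟩)) (Submodule.mem_sup_left hp)
      rw [show rt c (1 : G) = id from funext (rt_one c), Finsupp.mapDomain_id]
    · intro g v hv
      show (tr D : (Ty₄ A → ℤ) →ₗ[ℤ] (CMF G c →₀ ℤ)) (translH₄ A g v) ∈ T
      rw [LinearEquiv.coe_coe, tr_translH₄]; exact hTstab _ _ hv
    · intro v hv
      show (tr D : (Ty₄ A → ℤ) →ₗ[ℤ] (CMF G c →₀ ℤ)) (translY A ζ v) ∈ T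
      rw [LinearEquiv.coe_coe, tr_translY]; exact hTstab _ _ hv
    · intro v hv
      show (tr D : (Ty₄ A → ℤ) →ₗ[ℤ] (CMF G c →₀ ℤ)) (translS A v) ∈ T
      rw [LinearEquiv.coe_coe, tr_translS]; exact hTstab _ _ hv
  have hmap : (hodge₄ A).map (tr D : (Ty₄ A → ℤ) →ₗ[ℤ] (CMF G c →₀ ℤ)) ≤ T := by
    refine (Submodule.map_mono hgen).trans ?_
    rw [Submodule.map_sup, map_pairs₄]
    exact sup_le le_sup_left (Submodule.map_le_iff_le_comap.mpr horb)
  refine ⟨S', ?_, Finset.card_image_le, ?_⟩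
  · intro y hy
    obtain ⟨f, hf, rfl⟩ := Finset.mem_image.mp (Finset.mem_coe.mp hy)
    exact (gfOf_spec D hc2 (hF f hf)).1
  · refine sup_le (Submodule.span_le.mpr ?_) le_sup_left
    rintro y ⟨Φ, t, t', ht', rfl⟩
    exact (sup_le hmap le_sup_left) (gface_mem D hc2 Φ ht' (A := A))

end

end Summit.HodgeConjecture.CorCM.Census.ShearedDihedral
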